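import Mathlib.Analysis.InnerProductSpace.PiL2
import Literature.Analysis.FluidPDE.SelfSimilar
import Literature.Analysis.FluidPDE.AxisymmetricEuler
import HarnessLib

/-!
# Liouville theorem for bounded steady Navier–Stokes flows in a periodic slab `ℝ² × 𝕋`

Topic `Literature/Analysis/FluidPDE`; ONE named fact (result in print, `def … : Prop`, D-0014),
typed for the blow-up scenario census of `NavierStokesRegularity` (cell `pub/ns-census`,
PRINT-STATUS §17: block S "steady · periodic in `x₃` · NO symmetry" and the calibration of the
«thin-period» cells A13 / A8th), as a sibling of `SteadyHelicalLiouville.lean` (row S6, helical)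
and `SteadyLiouvilleCriteria.lean` (Galdi's problem).

**Source.** J. Bang, C. Gui, Y. Wang, C. Xie, *Liouville-type theorems for steady solutions to the
Navier–Stokes system in a slab*, J. Fluid Mech. **1005** (2025) A6 = arXiv:2205.13259
[BangGuiWangXie2025] (held text = the arXiv version; chunk/line locators below refer to it):
* §1 (chunk p0003 L8–18): the steady system `−Δu + (u·∇)u + ∇P = 0`, `∇·u = 0` (viscosity `1`) in
  the slab `ℝ² × [0,1]` with no-slip conditions, "or with the periodic boundary condition in `x₃`.
  In the latter case, we may denote the domain by `ℝ² × 𝕋` and regard the flows as periodic flows in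
  one direction. Note that the solutions of (1.1) in `ℝ² × 𝕋` can also be regarded as solutions in
  the whole `ℝ³`." The period is `1` (§2: `𝒪_R = (B_R ∖ B̄_{R−1}) × (0,1)`; §5, Lemma 5.1:
  `P(r,θ,z+1) − P(r,θ,z)`); cylindrical components `u = u^r e_r + u^θ e_θ + u^z e_z` (p0003 L36).
* **Theorem 1.4** (the fourth theorem of §1, stated before Remark 1.10; chunk p0004 L60–72; the
  held LaTeX text drops theorem numbers — `1.4` is inferred from Remarks 1.1–1.10 and from
  "the proof of Theorem 1.3" at p0015 L85; proof = §5, chunks p0013–p0015):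
  "Let `u` be a bounded smooth solution to the Navier–Stokes system (1.1) in `ℝ² × 𝕋`. Then `u` must
  be a constant vector provided that one of the following conditions holds:
  (a) `u^θ` is axisymmetric, i.e., `u^θ` is independent of `θ`; (b) `u^r` is axisymmetric, i.e.,
  `u^r` is independent of `θ`; (c) `r u^r` converges to `0`, as `r → +∞`; (d) `‖u‖_{L^∞(Ω)} < 2π`.
  Furthermore, in all cases (a), (b), and (c), the only nonzero component of the velocity field must
  be `u^z`, i.e., the constant vector `u` must be of the form `(0, 0, c)`."
  Remark 1.10 (p0004 L74–75): axisymmetric solutions satisfy (a), so "any bounded axisymmetric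
  solution periodic in the axial direction must be of the form `(0,0,c)`."
* Printed proof of (d) (p0015 L47–90): differentiate the momentum equation in `x₃`, test with
  `∂₃u φ_R`; the Wirtinger inequality `‖∂₃u √φ_R‖ ≤ (2π)⁻¹ ‖∂₃²u √φ_R‖` (period `1`, `∂₃u` has
  zero mean in `x₃`) absorbs the convection term when `‖u‖_∞ < 2π`; a Saint-Venant estimate
  `Z(R) ≤ C R^{1/2} Z'(R)^{1/2}` for `Z(R) = ∫ |∇∂₃u|² φ_R` forces `∇∂₃u ≡ 0`, hence `u` is
  independent of `x₃`, `(u₁,u₂)` is a bounded 2D steady solution, constant by [KNSS], and `u₃` is a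
  bounded harmonic-type function, constant. Cases (a)–(c): §5 Steps 1–3 (Saint-Venant growth of
  the Dirichlet integral over cylinders, Bogovskii corrector, pressure periodicity Lemma 5.1).

## Rendering choices (all in the tree's vocabulary; nothing re-declared)
* "smooth solution … in `ℝ² × 𝕋`" = the tree's steady profile structure `IsLerayProfile ν 0 U P`
  on `ℝ³` (`SelfSimilar.lean`: `U ∈ C²`, `P ∈ C¹`, `−νΔU + (U·∇)U + ∇P = 0`, `div U = 0`
  pointwise) plus `ContDiff ℝ ∞` of `U` and `P`, plus periodicity of `U` along the axis,
  `IsAxiallyPeriodic L U` (`AxisymmetricEuler.lean`: `U (x + L e₃) = U x`). Periodicity of `P` is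
  NOT assumed: for bounded periodic `u` it is the source's Lemma 5.1 (p0013 L5–24), i.e. part of
  the proof, and the source itself regards solutions in `ℝ² × 𝕋` as solutions in `ℝ³` (p0003 L18).
  Requiring smoothness of `P` as well only weakens the fact (as in the sibling files).
* "bounded" = `∃ M, ∀ x, ‖U x‖ ≤ M` (Euclidean norm of `ℝ³`, the norm of `EuclideanSpace`).
* (a)/(b): "`u^θ` (`u^r`) independent of `θ`" = invariance of the scalar field under all rotations
  about the axis, `IsAxisymmetricScalar (swirlVelocity U)` / `IsAxisymmetricScalar
  (radialVelocity U)` (`AxisymmetricEuler.lean`: `u_θ = ⟪U x, e_θ x⟫`, `u_r = ⟪U x, e_r x⟫`, junk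
  `0` on the axis where the printed components are undefined — harmless, the axis is
  rotation-fixed).
* (c): "`r u^r → 0` as `r → +∞`" is read UNIFORMLY in `(θ, z)` — this is how §5 Step 3 uses it
  (p0015 L43: "`Y(R₀) ≥ 2C₁ R ‖u^r‖_{L^∞(𝒪_R)}` for every `R ≥ R₁`"); the uniform reading is the
  stronger hypothesis, so the typed fact is implied by any reading of the print.
* Viscosity and period. Printed: `ν = 1`, period `1`, threshold `2π`. Stated here for every
  `ν > 0` and every period `L > 0` with threshold `2πν/L` in (d): if `(U, P)` solves the
  `ν`-system with period `L`, then `V(y) = (L/ν) U(Ly)`, `Q(y) = (L/ν)² P(Ly)` solve the printed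
  system (`−ΔV + (V·∇)V + ∇Q = (L³/ν²)(−νΔU + (U·∇)U + ∇P)(Ly) = 0`), `V` has period `1`,
  `‖V‖_∞ = (L/ν)‖U‖_∞`, hypotheses (a)–(c) and both conclusions are invariant under this map.
  The scale-invariant quantity `L‖u‖_∞/ν` is the "period–Reynolds number" of the census cells
  A13/A8th; (d) reads `Re_L < 2π`.
* Conclusions: "constant vector" = `∃ C, U = fun _ ↦ C`; "of the form `(0,0,c)`" =
  `∃ c : ℝ, U = fun _ ↦ c • eZ`. Both printed conclusions are packed into ONE `Prop` (a
  conjunction under the common hypotheses), so the file adds exactly one named fact.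

## Deliberately statement-only
Nothing is proved here (Literature = cited statements; D-0014/D-0026: one fact, no helpers). NOT
vendored: Theorems 1.1–1.3 of the source (no-slip slab `ℝ² × [0,1]`: axisymmetric or `r u^r`
bounded ⇒ `u ≡ 0`; growth conditions; `‖u‖_∞ < π` ⇒ Poiseuille flow) — other boundary
conditions, other census block; and no statement about time-dependent (ancient) periodic
solutions, for which nothing is in print without axisymmetry (Lei–Ren–Zhang, Math. Ann. 383
(2022), Thm 1, is the axisymmetric `ℝ² × 𝕋` ancient Liouville theorem, tree
`leiRenZhang2019_liouville_periodic`).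
-/

noncomputable section

open MeasureTheory Filter Set
open _root_.Topology

namespace Literature.Analysis.FluidPDE

/-- **Liouville theorem for bounded steady flows in the periodic slab `ℝ² × 𝕋`**
(Bang–Gui–Wang–Xie 2025, Theorem 1.4 of the arXiv text: "Let `u` be a bounded smooth solution to
the Navier–Stokes system in `ℝ² × 𝕋`. Then `u` must be a constant vector provided that one of the
following conditions holds: (a) `u^θ` is independent of `θ`; (b) `u^r` is independent of `θ`;
(c) `r u^r` converges to `0` as `r → +∞`; (d) `‖u‖_{L^∞(Ω)} < 2π`. Furthermore, in all cases
(a), (b), and (c), … `u` must be of the form `(0,0,c)`."). For every viscosity `ν > 0` and period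
`L > 0` (printed `ν = 1`, `L = 1`; scaling `V(y) = (L/ν)U(Ly)`, see the module docstring): a
smooth steady solution `IsLerayProfile ν 0 U P` on `ℝ³` with `U` bounded and `L`-periodic in `x₃`
(`IsAxiallyPeriodic L U`) is (i) an axial constant `c e₃` if `u_θ` or `u_r` is rotation-invariant
or `r u_r → 0` uniformly as `r → ∞`, and (ii) a constant vector if `sup ‖U‖ < 2πν/L` — case (ii)
assumes NO symmetry (printed proof: Wirtinger's inequality in `x₃` with constant `(2π)⁻¹`,
Saint-Venant estimate for `∫|∇∂₃u|²φ_R`, then the 2D Liouville theorem of [KNSS]). Not proved in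
the tree.
[cite: BangGuiWangXie2025, Thm 1.4 (periodic slab, cases (a)–(d); arXiv:2205.13259 §1 p.4, proof §5)] -/
def BangGuiWangXie2025_periodicSlab_liouville : Prop :=
  ∀ ν : ℝ, 0 < ν → ∀ L : ℝ, 0 < L →
    ∀ (U : EuclideanSpace ℝ (Fin 3) → EuclideanSpace ℝ (Fin 3)) (P : EuclideanSpace ℝ (Fin 3) → ℝ),
      IsLerayProfile ν 0 U P → ContDiff ℝ (⊤ : ℕ∞) U → ContDiff ℝ (⊤ : ℕ∞) P →
      (∃ M : ℝ, ∀ x, ‖U x‖ ≤ M) → IsAxiallyPeriodic L U →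
        ((IsAxisymmetricScalar (swirlVelocity U) ∨ IsAxisymmetricScalar (radialVelocity U) ∨
            (∀ ε : ℝ, 0 < ε → ∃ R : ℝ, ∀ x, R ≤ cylRadius x →
              |cylRadius x * radialVelocity U x| ≤ ε)) →
          ∃ c : ℝ, U = fun _ => c • eZ) ∧
        ((∃ M : ℝ, M < 2 * Real.pi * ν / L ∧ ∀ x, ‖U x‖ ≤ M) →
          ∃ C : EuclideanSpace ℝ (Fin 3), U = fun _ => C)

end Literature.Analysis.FluidPDE

end
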